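import Literature.AlgebraicGeometry.KTheory.EulerCharResolutionIndependence
import Literature.AlgebraicGeometry.Morphisms.FormalFunctionsModule
import Mathlib.Algebra.Homology.DerivedCategory.HomologySequence
import Mathlib.CategoryTheory.Triangulated.TStructure.TruncLTGE
import HarnessLib

/-!
# The Euler characteristic `χ(K) ∈ K₀(X)` of a bounded complex of vector bundles depends only on the class of `K` in the derived
# category — by AMPLITUDE INDUCTION from the existence of finite locally free resolutions (no resolution of roof apices)

Layer `Literature/AlgebraicGeometry/KTheory` (0 NEW named facts, no instances). For a locally noetherian scheme `X` on which every coherent module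
has a strictly perfect resolution (`hres`, a displayed HYPOTHESIS; on a complex abelian variety it follows from [SP]
`ThomasonTrobaugh_vbModel_of_boundedCoh`, `Modules/StrictlyPerfectResolutionOfVBModel`; on a noetherian integral separated regular scheme it is
the displayed fact `Hartshorne1977_exists_strictlyPerfectResolution`):

**`IsBoundedVBComplex.eulerChar_eq_of_nonempty_iso_Q`** — if `K`, `K′` are bounded complexes of finite locally free `𝒪_X`-modules with
`Nonempty (DerivedCategory.Q.obj K ≅ DerivedCategory.Q.obj K′)`, then `eulerChar K = eulerChar K′` in `K₀(X)`. With
`HodgeTheory/ChPerfectZigzag` (one-map and VB-apex zigzag forms) this is the unrestricted «two bounded vector-bundle models of one object of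
`D(Mod 𝒪_X)` have the same class», i.e. well-definedness of `K₀(D^b_{VB}) → K₀(X)` on isomorphism classes of the derived category
(Schlichting Exercise 3.1.4; SGA 6 IV §2; Fulton §15.1 for `ch`). The derived isomorphism is NEVER unwound into a chain-level roof (whose apex has
arbitrary terms); instead:

## Proof (amplitude induction)

By induction on the cohomological amplitude `[a, b]` of `K` (shared by `K′`, `DerivedCategory.isGE_Q_obj_iff`). Empty amplitude: both acyclic,
`χ = 0` (`eulerChar_eq_zero_of_acyclic`). Step, top degree `m = b`: (1) replace `K`, `K′` by their canonical truncations `τ^{≤m}`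
(`KTheory/TruncLEVectorBundle`: bounded VB complexes, `χ` unchanged), so both are concentrated in degrees `≤ m`; (2) `H := coker(Kᵐ⁻¹ → Kᵐ) = Hᵐ(K)`
is coherent and `π : K ⟶ H[-m]` is an epimorphism in degree `m` and a quasi-isomorphism in degree `m`; by `KTheory/AdaptedResolution` there are a
bounded VB complex `P ≤ m`, a quasi-isomorphism `ε : P ⟶ H[-m]` and a chain map `j : K ⟶ P` over `H[-m]`; likewise `P′`, `j′` for `K′`, both
resolving `H` (through `Hᵐ(K) ≅ Hᵐ(K′)`, `DerivedCategory.homologyFunctor`); (3) `χ(P) = χ(P′)` (`eulerChar_eq_of_quasiIso_toSingle`, the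
dominating-resolution argument) and `χ(Cone j) = χ(P) − χ(K)` (`eulerChar_mappingCone`); (4) the cones `C = Cone j`, `C′ = Cone j′` are bounded
VB complexes of amplitude `[a − 1, m − 2]` (long exact homology sequence of the cone triangle in `D(Mod 𝒪_X)`,
`Functor.IsHomological.homologySequence_exact₃`, with `Hᵐ(j)` an isomorphism) and `Q C ≅ Q C′`: the rotated cone triangles
`(Q C)⟦-1⟧ → Q K → Q P → Q C` and `(Q C′)⟦-1⟧ → Q K′ → Q P′ → Q C′` have first vertex in `D^{≤ m-1}` and third vertex in `D^{≥ m}`, so the given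
`Q K ≅ Q K′` extends to an isomorphism of triangles (uniqueness of t-structure truncations, Mathlib `TStructure.triangle_iso_exists`); the induction
hypothesis gives `χ(C) = χ(C′)`, whence `χ(K) = χ(K′)`.

Also: the `D⁺` variant `eulerChar_eq_of_nonempty_iso_plusQ` (p730091's socket output is a `DerivedCategory.Plus` isomorphism) and the complex
abelian variety corollary `eulerChar_eq_of_nonempty_iso_Q_of_vbModel` under `hSP` ONLY. The `ch`-twin is `HodgeTheory/ChPerfectOfDerivedIso`.
Research route conditional on HC_CM; not a corollary; nothing here refers to it.

## References

* M. Schlichting, *Higher algebraic K-theory*, LNM 2008 (2011), §3.1.3–3.1.4, Exercise 3.1.4. [Schlichting2011HigherKTheory]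
* P. Berthelot, A. Grothendieck, L. Illusie, *SGA 6*, Exp. IV §2 (`K•` of perfect complexes). [SGA6]
* W. Fulton, *Intersection Theory*, 2nd ed. (1998), §15.1, App. B.8.3. [Fulton1998]
* R. W. Thomason, T. Trobaugh, *Higher algebraic K-theory of schemes and of derived categories* (1990), 1.9.x, Prop. 2.3.1 (d). [ThomasonTrobaugh1990]
* A. A. Beilinson, J. Bernstein, P. Deligne, *Faisceaux pervers*, Astérisque 100 (1982), Prop. 1.3.3 (uniqueness of t-truncations). [BBD1982]
-/

noncomputable section

universe w u

open CategoryTheory CategoryTheory.Limits AlgebraicGeometry ZeroObject HomologicalComplex Pretriangulated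

namespace Literature.AlgebraicGeometry.KTheory

open Literature.AlgebraicGeometry.Modules Literature.AlgebraicGeometry.Morphisms Literature.AlgebraicGeometry.Motives
  Literature.Algebra.Homology.AttachCell Literature.AlgebraicGeometry.KTheory.Adapted

variable {X : Scheme.{u}}

/-! ### §1 The top cohomology sheaf and the projection `π : K ⟶ Hᵐ(K)[-m]` -/

section Top

variable (K : CochainComplex X.Modules ℤ) (m : ℤ) [K.IsStrictlyLE m]

/-- `Hᵐ(K) := coker(Kᵐ⁻¹ → Kᵐ)` (Mathlib's `K.opcycles m`; for `K` concentrated in degrees `≤ m` this is the top cohomology sheaf).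
[cite: Fulton1998, App. B.8.3] -/
abbrev topH : X.Modules := K.opcycles m

/-- The projection `π : K ⟶ Hᵐ(K)[-m]`. [cite: Fulton1998, App. B.8.3] -/
def topπ : K ⟶ (HomologicalComplex.single X.Modules (ComplexShape.up ℤ) m).obj (topH K m) :=
  HomologicalComplex.mkHomToSingle (K.pOpcycles m) (fun i (hi : i + 1 = m) ↦ by subst hi; exact K.d_pOpcycles _ _)

/-- In degree `m`, `π` followed by `(H[-m])ᵐ ≅ H` is the quotient map `Kᵐ ↠ Hᵐ(K)`. [cite: Fulton1998, App. B.8.3] -/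
theorem topπ_f : (topπ K m).f m ≫ (HomologicalComplex.singleObjXSelf (ComplexShape.up ℤ) m (topH K m)).hom = K.pOpcycles m := by
  rw [topπ, HomologicalComplex.mkHomToSingle_f, Category.assoc, Iso.inv_hom_id, Category.comp_id]

/-- `π` is an epimorphism in degree `m`. [cite: Fulton1998, App. B.8.3] -/
theorem epi_topπ_f : Epi ((topπ K m).f m) := by
  have h : (topπ K m).f m = K.pOpcycles m ≫ (HomologicalComplex.singleObjXSelf (ComplexShape.up ℤ) m (topH K m)).inv := by
    rw [← topπ_f, Category.assoc, Iso.hom_inv_id, Category.comp_id]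
  rw [h]
  exact epi_comp _ _

/-- `π` is a quasi-isomorphism in degree `m` (`Kᵐ⁻¹ → Kᵐ → Hᵐ(K) → 0` is exact and `Kᵐ⁺¹ = 0`). [cite: Fulton1998, App. B.8.3] -/
theorem quasiIsoAt_topπ : QuasiIsoAt (topπ K m) m := by
  rw [quasiIsoAt_toSingle_iff K m (K.isZero_of_isStrictlyLE m (m + 1) (by omega)) _ (topπ K m)]
  have hex : (ShortComplex.mk (K.d (m - 1) m) (K.pOpcycles m) (K.d_pOpcycles _ _)).Exact :=
    ShortComplex.exact_of_g_is_cokernel _ (K.opcyclesIsCokernel (m - 1) m (by simp))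
  refine ⟨ShortComplex.exact_of_iso (S₁ := ShortComplex.mk (K.d (m - 1) m) (K.pOpcycles m) (K.d_pOpcycles _ _))
    (ShortComplex.isoMk (Iso.refl _) (Iso.refl _) (Iso.refl _) (by simp) (by simp [topπ_f])) hex, ?_⟩
  rw [topπ_f]
  infer_instance

omit [K.IsStrictlyLE m] in
/-- `Hᵐ(K)` is coherent when `Kᵐ⁻¹`, `Kᵐ` are vector bundles (`X` locally noetherian). [cite: Hartshorne1977, II Prop. 5.7 (p. 114)] -/
theorem coh_topH [IsLocallyNoetherian X] (hK : IsBoundedVBComplex K) : Coh (topH K m) :=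
  coh_of_iso' ((cokernelIsCokernel (K.d (m - 1) m)).coconePointUniqueUpToIso (K.opcyclesIsCokernel (m - 1) m (by simp)))
    (Coh.cokernel (K.d (m - 1) m) (coh_of_isFiniteLocallyFree (hK.isFiniteLocallyFree (m - 1)))
      (coh_of_isFiniteLocallyFree (hK.isFiniteLocallyFree m)))

variable [HasDerivedCategory.{w} X.Modules]

/-- `Hᵐ(K)` through the derived category: `(homologyFunctor m)(Q K) ≅ Hᵐ(K)` for `K` concentrated in degrees `≤ m`.
[cite: BBD1982, Prop. 1.3.3] -/
def homologyObjIsoTopH : (DerivedCategory.homologyFunctor X.Modules m).obj (DerivedCategory.Q.obj K) ≅ topH K m :=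
  (DerivedCategory.homologyFunctorFactors X.Modules m).app K ≪≫
    K.isoHomologyι m (m + 1) (by simp) ((K.isZero_of_isStrictlyLE m (m + 1) (by omega)).eq_of_tgt _ _)

end Top

/-! ### §2 The cone of `j : K ⟶ P` over `Hᵐ(K)[-m]`: amplitude and derived class -/

section Cone

variable [IsLocallyNoetherian X] [HasDerivedCategory.{w} X.Modules] {K P : CochainComplex X.Modules ℤ} {m : ℤ}
  [K.IsStrictlyLE m] [P.IsStrictlyLE m] {H : X.Modules}
  (π : K ⟶ (HomologicalComplex.single X.Modules (ComplexShape.up ℤ) m).obj H) (hπ : QuasiIsoAt π m)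
  (ε : P ⟶ (HomologicalComplex.single X.Modules (ComplexShape.up ℤ) m).obj H) (hε : QuasiIso ε)
  (j : K ⟶ P) (hj : j ≫ ε = π)

/-- The cone triangle `Q K → Q P → Q(Cone j) → (Q K)⟦1⟧` in `D(Mod 𝒪_X)`. [cite: BBD1982, Prop. 1.3.3] -/
abbrev coneTriangle (j : K ⟶ P) : Triangle (DerivedCategory X.Modules) :=
  DerivedCategory.Q.mapTriangle.obj (CochainComplex.mappingCone.triangle j)

omit [IsLocallyNoetherian X] [K.IsStrictlyLE m] [P.IsStrictlyLE m] in
include hπ hε hj in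
/-- `Hᵐ(j) : Hᵐ(K) → Hᵐ(P)` is an isomorphism (`Hᵐ(j) ≫ Hᵐ(ε) = Hᵐ(π)`, both isomorphisms). [cite: BBD1982, Prop. 1.3.3] -/
theorem isIso_homologyMap_j : IsIso ((DerivedCategory.homologyFunctor X.Modules m).map (DerivedCategory.Q.map j)) := by
  haveI := hε
  haveI : IsIso (HomologicalComplex.homologyMap π m) := by
    haveI := hπ; infer_instance
  haveI : IsIso (HomologicalComplex.homologyMap j m ≫ HomologicalComplex.homologyMap ε m) := by
    rw [← HomologicalComplex.homologyMap_comp, hj]; infer_instance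
  haveI : IsIso (HomologicalComplex.homologyMap j m) := IsIso.of_isIso_comp_right _ (HomologicalComplex.homologyMap ε m)
  exact (NatIso.isIso_map_iff (DerivedCategory.homologyFunctorFactors X.Modules m) j).2
    (inferInstanceAs (IsIso (HomologicalComplex.homologyMap j m)))

omit [IsLocallyNoetherian X] [K.IsStrictlyLE m] [P.IsStrictlyLE m] in
include hε in
/-- `Q P` lies in `D^{≥ m}` (`P ≃ H[-m]`). [cite: BBD1982, Prop. 1.3.3] -/
theorem isGE_Q_P : (DerivedCategory.Q.obj P).IsGE m := by
  haveI := hε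
  exact DerivedCategory.TStructure.t.isGE_of_iso (asIso (DerivedCategory.Q.map ε)).symm m

omit [IsLocallyNoetherian X] [K.IsStrictlyLE m] [P.IsStrictlyLE m] in
include hε in
/-- `P` is exact in every degree `≠ m`. [cite: BBD1982, Prop. 1.3.3] -/
theorem isZero_homology_P (i : ℤ) (hi : i ≠ m) : IsZero ((DerivedCategory.homologyFunctor X.Modules i).obj (DerivedCategory.Q.obj P)) := by
  haveI := hε
  have h : P.ExactAt i := (exactAt_iff_of_quasiIsoAt ε i).2 (HomologicalComplex.exactAt_single_obj _ _ _ _ hi)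
  exact h.isZero_homology.of_iso ((DerivedCategory.homologyFunctorFactors X.Modules i).app P)

include hπ hε hj in
omit [IsLocallyNoetherian X] in
/-- **The cone of `j` has cohomology in degrees `≤ m − 2`**: the long exact sequence of `Q K → Q P → Q(Cone j)` with `Hᵐ⁺¹(K) = 0`,
`Hᵐ⁻¹(P) = 0` and `Hᵐ(j)` an isomorphism. [cite: BBD1982, Prop. 1.3.3] [cite: Weibel1994, 1.5.7 (long exact sequence of the cone)] -/
theorem isLE_Q_mappingCone : (DerivedCategory.Q.obj (CochainComplex.mappingCone j)).IsLE (m - 2) := by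
  let F := DerivedCategory.homologyFunctor X.Modules 0
  let T := coneTriangle j
  have hT : T ∈ distTriang _ := DerivedCategory.mappingCone_triangle_distinguished j
  haveI hjiso : IsIso ((F.shift m).map T.mor₁) := by
    change IsIso ((DerivedCategory.homologyFunctor X.Modules m).map (DerivedCategory.Q.map j))
    exact isIso_homologyMap_j π hπ ε hε j hj
  -- `Hᵐ(C) = 0`
  have hm : IsZero ((DerivedCategory.homologyFunctor X.Modules m).obj (DerivedCategory.Q.obj (CochainComplex.mappingCone j))) := by
    have h₂ : (F.shift m).map T.mor₂ = 0 := (F.homologySequence_epi_shift_map_mor₁_iff T hT m).1 inferInstance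
    have hz : IsZero ((F.shift (m + 1)).obj T.obj₁) := by
      change IsZero ((DerivedCategory.homologyFunctor X.Modules (m + 1)).obj (DerivedCategory.Q.obj K))
      exact DerivedCategory.isZero_of_isLE _ m (m + 1) (by omega)
    exact (F.homologySequence_exact₃ T hT m (m + 1) rfl).isZero_of_both_zeros h₂ (hz.eq_of_tgt _ _)
  -- `Hᵐ⁻¹(C) = 0`
  have hm₁ : IsZero ((DerivedCategory.homologyFunctor X.Modules (m - 1)).obj (DerivedCategory.Q.obj (CochainComplex.mappingCone j))) := by
    have hz : IsZero ((F.shift (m - 1)).obj T.obj₂) := by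
      change IsZero ((DerivedCategory.homologyFunctor X.Modules (m - 1)).obj (DerivedCategory.Q.obj P))
      exact isZero_homology_P ε hε (m - 1) (by omega)
    have h₂ : (F.shift (m - 1)).map T.mor₂ = 0 := hz.eq_of_src _ _
    have hδ : F.homologySequenceδ T (m - 1) m (by omega) = 0 := (F.homologySequence_mono_shift_map_mor₁_iff T hT (m - 1) m (by omega)).1
      (inferInstance : Mono ((F.shift m).map T.mor₁))
    exact (F.homologySequence_exact₃ T hT (m - 1) m (by omega)).isZero_of_both_zeros h₂ hδ
  -- degrees `> m`: the cone is concentrated in degrees `≤ m`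
  haveI : K.IsStrictlyLE (m + 1) := K.isStrictlyLE_of_le m (m + 1) (by omega)
  haveI : (CochainComplex.mappingCone j).IsStrictlyLE m := isStrictlyLE_mappingCone j m
  rw [DerivedCategory.isLE_iff]
  intro i hi
  rcases lt_trichotomy i m with hlt | rfl | hgt
  · obtain rfl : i = m - 1 := by omega
    exact hm₁
  · exact hm
  · exact DerivedCategory.isZero_of_isLE _ m i hgt

omit [IsLocallyNoetherian X] [K.IsStrictlyLE m] [P.IsStrictlyLE m] in
include hε in
/-- The cone of `j` lies in `D^{≥ a − 1}` when `K ∈ D^{≥ a}` (`a ≤ m + 1`). [cite: BBD1982, Prop. 1.3.3] -/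
theorem isGE_Q_mappingCone (a : ℤ) (ha : a ≤ m + 1) [K.IsGE a] : (DerivedCategory.Q.obj (CochainComplex.mappingCone j)).IsGE (a - 1) := by
  have hT := rot_of_distTriang _ (DerivedCategory.mappingCone_triangle_distinguished j)
  haveI := isGE_Q_P ε hε
  haveI : (DerivedCategory.Q.obj P).IsGE (a - 1) := DerivedCategory.TStructure.t.isGE_of_ge _ (a - 1) m (by omega)
  haveI : DerivedCategory.TStructure.t.IsGE ((DerivedCategory.Q.obj K)⟦(1 : ℤ)⟧) (a - 1) :=
    DerivedCategory.TStructure.t.isGE_shift _ a 1 (a - 1) (by omega)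
  exact DerivedCategory.TStructure.t.isGE₂ _ hT (a - 1)
    (inferInstanceAs ((DerivedCategory.Q.obj P).IsGE (a - 1)))
    (inferInstanceAs (DerivedCategory.TStructure.t.IsGE ((DerivedCategory.Q.obj K)⟦(1 : ℤ)⟧) (a - 1)))

/-- The ROTATED cone triangle `(Q C)⟦-1⟧ → Q K → Q P → Q C`. [cite: BBD1982, Prop. 1.3.3] -/
abbrev invRotConeTriangle (j : K ⟶ P) : Triangle (DerivedCategory X.Modules) := (coneTriangle j).invRotate

omit [IsLocallyNoetherian X] [K.IsStrictlyLE m] [P.IsStrictlyLE m] [HasDerivedCategory X.Modules] in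
/-- It is distinguished. [cite: BBD1982, Prop. 1.3.3] -/
theorem invRotConeTriangle_distinguished [HasDerivedCategory.{w} X.Modules] (j : K ⟶ P) : invRotConeTriangle j ∈ distTriang _ :=
  inv_rot_of_distTriang _ (DerivedCategory.mappingCone_triangle_distinguished j)

include hπ hε hj in
omit [IsLocallyNoetherian X] in
/-- Its first vertex `(Q C)⟦-1⟧` lies in `D^{≤ m − 1}`. [cite: BBD1982, Prop. 1.3.3] -/
theorem isLE_invRotConeTriangle_obj₁ : DerivedCategory.TStructure.t.IsLE (invRotConeTriangle j).obj₁ (m - 1) := by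
  haveI := isLE_Q_mappingCone π hπ ε hε j hj
  exact DerivedCategory.TStructure.t.isLE_shift (DerivedCategory.Q.obj (CochainComplex.mappingCone j)) (m - 2) (-1) (m - 1) (by omega)

end Cone

/-! ### §3 The amplitude induction -/

section Induction

variable [IsLocallyNoetherian X] (hres : ∀ G : X.Modules, Coh G → Nonempty (StrictlyPerfectResolution G))
  [HasDerivedCategory.{w} X.Modules]

include hres in
/-- **The inductive step at top degree `m`** for complexes concentrated in degrees `≤ m`: assuming the statement for all pairs of bounded VB
complexes of cohomological amplitude `[a − 1, m − 2]`, it holds for pairs in `D^{≥ a}` concentrated in degrees `≤ m`.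
[cite: Schlichting2011HigherKTheory, Exercise 3.1.4] [cite: Fulton1998, App. B.8.3 (v) and §15.1] [cite: BBD1982, Prop. 1.3.3] -/
theorem eulerChar_eq_step {a m : ℤ}
    (IH : ∀ (C C' : CochainComplex X.Modules ℤ) (hC : IsBoundedVBComplex C) (hC' : IsBoundedVBComplex C'),
      C.IsGE (a - 1) → C.IsLE (m - 2) → Nonempty (DerivedCategory.Q.obj C ≅ DerivedCategory.Q.obj C') →
        eulerChar C hC.isFiniteLocallyFree = eulerChar C' hC'.isFiniteLocallyFree)
    {K K' : CochainComplex X.Modules ℤ} (hK : IsBoundedVBComplex K) (hK' : IsBoundedVBComplex K') [K.IsStrictlyLE m] [K'.IsStrictlyLE m]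
    [K.IsGE a] (ham : a ≤ m + 1) (e : DerivedCategory.Q.obj K ≅ DerivedCategory.Q.obj K') :
    eulerChar K hK.isFiniteLocallyFree = eulerChar K' hK'.isFiniteLocallyFree := by
  -- the common top cohomology sheaf `H = Hᵐ(K) ≅ Hᵐ(K')`
  let φ : topH K' m ≅ topH K m :=
    (homologyObjIsoTopH K' m).symm ≪≫ ((DerivedCategory.homologyFunctor X.Modules m).mapIso e).symm ≪≫ homologyObjIsoTopH K m
  let π' : K' ⟶ (HomologicalComplex.single X.Modules (ComplexShape.up ℤ) m).obj (topH K m) :=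
    topπ K' m ≫ (HomologicalComplex.single X.Modules (ComplexShape.up ℤ) m).map φ.hom
  have hπ'f : Epi (π'.f m) := by
    haveI := epi_topπ_f K' m
    rw [HomologicalComplex.comp_f]
    exact epi_comp _ _
  have hπ'q : QuasiIsoAt π' m := by
    haveI := quasiIsoAt_topπ K' m
    exact quasiIsoAt_comp _ _ m
  -- adapted resolutions of `H[-m]` receiving `K` and `K'`
  obtain ⟨P, j, ε, hP, hPle, hjε, hε⟩ := exists_adaptedResolution hres hK (coh_topH K m hK) (topπ K m) (epi_topπ_f K m)
  obtain ⟨P', j', ε', hP', hP'le, hjε', hε'⟩ := exists_adaptedResolution hres hK' (coh_topH K m hK) π' hπ'f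
  -- `χ(P) = χ(P')` (two resolutions of the same `H[-m]`) and `χ(Cone) = χ(P) − χ(K)`
  have hPP : eulerChar P hP.isFiniteLocallyFree = eulerChar P' hP'.isFiniteLocallyFree :=
    IsBoundedVBComplex.eulerChar_eq_of_quasiIso_toSingle hres (coh_topH K m hK) hP hP' ε ε' hε hε'
  have hC := eulerChar_mappingCone hK hP j
  have hC' := eulerChar_mappingCone hK' hP' j'
  -- the cones: amplitude `[a-1, m-2]` and isomorphic derived classes
  haveI : K'.IsGE a := (DerivedCategory.isGE_Q_obj_iff K' a).1 (DerivedCategory.TStructure.t.isGE_of_iso e a)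
  have hTK := invRotConeTriangle_distinguished (X := X) j
  have hTK' := invRotConeTriangle_distinguished (X := X) j'
  obtain ⟨e', _⟩ := DerivedCategory.TStructure.t.triangle_iso_exists hTK hTK' e (m - 1) m
    (isLE_invRotConeTriangle_obj₁ (topπ K m) (quasiIsoAt_topπ K m) ε hε j hjε) (isGE_Q_P ε hε)
    (isLE_invRotConeTriangle_obj₁ π' hπ'q ε' hε' j' hjε') (isGE_Q_P ε' hε')
  have e₁ : (DerivedCategory.Q.obj (CochainComplex.mappingCone j))⟦(-1 : ℤ)⟧ ≅
      (DerivedCategory.Q.obj (CochainComplex.mappingCone j'))⟦(-1 : ℤ)⟧ := Triangle.π₁.mapIso e'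
  have eC : DerivedCategory.Q.obj (CochainComplex.mappingCone j) ≅ DerivedCategory.Q.obj (CochainComplex.mappingCone j') :=
    (shiftNegShift _ (1 : ℤ)).symm ≪≫ (CategoryTheory.shiftFunctor (DerivedCategory X.Modules) (1 : ℤ)).mapIso e₁ ≪≫
      shiftNegShift _ (1 : ℤ)
  haveI := isGE_Q_mappingCone ε hε j a ham
  haveI := isLE_Q_mappingCone (topπ K m) (quasiIsoAt_topπ K m) ε hε j hjε
  have hCC := IH _ _ (hK.mappingCone hP j) (hK'.mappingCone hP' j')
    ((DerivedCategory.isGE_Q_obj_iff _ _).1 inferInstance) ((DerivedCategory.isLE_Q_obj_iff _ _).1 inferInstance) ⟨eC⟩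
  rw [hCC, hPP, hC'] at hC
  exact (sub_right_injective hC).symm

include hres in
/-- **The amplitude induction**: for bounded VB complexes `K ∈ D^{[a, b]}` with `b < a + n`. [cite: Schlichting2011HigherKTheory, Exercise 3.1.4]
[cite: BBD1982, Prop. 1.3.3] -/
theorem eulerChar_eq_of_amplitude (n : ℕ) :
    ∀ (a b : ℤ) (_ : b < a + n) (K K' : CochainComplex X.Modules ℤ) (hK : IsBoundedVBComplex K) (hK' : IsBoundedVBComplex K'),
      K.IsGE a → K.IsLE b → Nonempty (DerivedCategory.Q.obj K ≅ DerivedCategory.Q.obj K') →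
        eulerChar K hK.isFiniteLocallyFree = eulerChar K' hK'.isFiniteLocallyFree := by
  induction n with
  | zero =>
    intro a b hab K K' hK hK' hGE hLE ⟨e⟩
    haveI := hGE
    haveI := hLE
    haveI : K'.IsGE a := (DerivedCategory.isGE_Q_obj_iff K' a).1 (DerivedCategory.TStructure.t.isGE_of_iso e a)
    haveI : K'.IsLE b := (DerivedCategory.isLE_Q_obj_iff K' b).1 (DerivedCategory.TStructure.t.isLE_of_iso e b)
    have hac : ∀ (L : CochainComplex X.Modules ℤ) [L.IsGE a] [L.IsLE b], L.Acyclic := fun L _ _ i ↦ by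
      by_cases hi : i < a
      · exact L.exactAt_of_isGE a i hi
      · exact L.exactAt_of_isLE b i (by omega)
    rw [hK.eulerChar_eq_zero_of_acyclic (hac K), hK'.eulerChar_eq_zero_of_acyclic (hac K')]
  | succ n ih =>
    intro a b hab K K' hK hK' hGE hLE ⟨e⟩
    by_cases hb : b < a + n
    · exact ih a b hb K K' hK hK' hGE hLE ⟨e⟩
    obtain rfl : b = a + n := by omega
    haveI := hGE
    haveI := hLE
    -- top-truncate both at `m := a + n`
    haveI : K'.IsLE (a + n) := (DerivedCategory.isLE_Q_obj_iff K' (a + n)).1 (DerivedCategory.TStructure.t.isLE_of_iso e (a + n))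
    have e₁ : DerivedCategory.Q.obj (K.truncLE (a + n)) ≅ DerivedCategory.Q.obj (K'.truncLE (a + n)) :=
      asIso (DerivedCategory.Q.map (K.ιTruncLE (a + n))) ≪≫ e ≪≫ (asIso (DerivedCategory.Q.map (K'.ιTruncLE (a + n)))).symm
    haveI : (K.truncLE (a + n)).IsGE a := (DerivedCategory.isGE_Q_obj_iff _ a).1
      (DerivedCategory.TStructure.t.isGE_of_iso (asIso (DerivedCategory.Q.map (K.ιTruncLE (a + n)))).symm a)
    rw [← hK.eulerChar_truncLE (a + n), ← hK'.eulerChar_truncLE (a + n)]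
    exact eulerChar_eq_step hres (a := a) (m := a + n)
      (fun C C' hC hC' hGE' hLE' hCC' ↦ ih (a - 1) (a + n - 2) (by omega) C C' hC hC' hGE' hLE' hCC')
      (hK.truncLE (a + n)) (hK'.truncLE (a + n)) (by omega) e₁

/-! ### §4 The theorems -/

include hres in
/-- **`χ(K) = χ(K′)` in `K₀(X)` for bounded complexes of vector bundles with isomorphic classes in the derived category `D(Mod 𝒪_X)`** —
under `hres` (every coherent module has a finite locally free resolution), `X` locally noetherian. The unrestricted form of the tree's
`IsBoundedVBComplex.eulerChar_eq_of_quasiIso` / `eulerChar_eq_of_roof`: no chain-level zigzag is needed. [cite: Schlichting2011HigherKTheory, Exercise 3.1.4]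
[cite: SGA6, Exp. IV §2] [cite: Fulton1998, §15.1] -/
theorem IsBoundedVBComplex.eulerChar_eq_of_nonempty_iso_Q {K K' : CochainComplex X.Modules ℤ} (hK : IsBoundedVBComplex K)
    (hK' : IsBoundedVBComplex K') (e : Nonempty (DerivedCategory.Q.obj K ≅ DerivedCategory.Q.obj K')) :
    eulerChar K hK.isFiniteLocallyFree = eulerChar K' hK'.isFiniteLocallyFree := by
  obtain ⟨b, hb⟩ := hK.exists_isZero_of_lt
  obtain ⟨a, ha⟩ := hK.exists_isZero_of_gt
  haveI : K.IsStrictlyGE a := (CochainComplex.isStrictlyGE_iff K a).2 (fun i hi ↦ ha i hi)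
  haveI : K.IsStrictlyLE b := (CochainComplex.isStrictlyLE_iff K b).2 (fun i hi ↦ hb i hi)
  exact eulerChar_eq_of_amplitude hres (b - a + 1).toNat a b (by omega) K K' hK hK' inferInstance inferInstance e

include hres in
/-- **`D⁺` variant**: for bounded VB complexes `K`, `K′` concentrated in degrees `≥ n`, `≥ n′` with isomorphic classes
`Plus.Q.obj ⟨K, n, _⟩ ≅ Plus.Q.obj ⟨K′, n′, _⟩` in the bounded-below derived category, `χ(K) = χ(K′)`.
[cite: Schlichting2011HigherKTheory, Exercise 3.1.4] [cite: SGA6, Exp. IV §2] -/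
theorem IsBoundedVBComplex.eulerChar_eq_of_nonempty_iso_plusQ {K K' : CochainComplex X.Modules ℤ} (hK : IsBoundedVBComplex K)
    (hK' : IsBoundedVBComplex K') {n n' : ℤ} (hn : K.IsStrictlyGE n) (hn' : K'.IsStrictlyGE n')
    (e : Nonempty (DerivedCategory.Plus.Q.obj ⟨K, n, hn⟩ ≅ DerivedCategory.Plus.Q.obj ⟨K', n', hn'⟩)) :
    eulerChar K hK.isFiniteLocallyFree = eulerChar K' hK'.isFiniteLocallyFree := by
  obtain ⟨e⟩ := e
  exact hK.eulerChar_eq_of_nonempty_iso_Q hres hK'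
    ⟨((DerivedCategory.quotientCompQhIso X.Modules).app K).symm ≪≫ DerivedCategory.Plus.ι.mapIso e ≪≫
      (DerivedCategory.quotientCompQhIso X.Modules).app K'⟩

end Induction

/-! ### §5 On a complex abelian variety, from [SP] alone -/

/-- **On a complex abelian variety: `χ(K) = χ(K′)` for bounded VB complexes with `Q K ≅ Q K′`**, under the displayed fact [SP]
`ThomasonTrobaugh_vbModel_of_boundedCoh` ONLY (it supplies the finite locally free resolutions,
`nonempty_strictlyPerfectResolution_of_coh`). [cite: ThomasonTrobaugh1990, Prop. 2.3.1 (d)] [cite: Schlichting2011HigherKTheory, Exercise 3.1.4] -/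
theorem IsBoundedVBComplex.eulerChar_eq_of_nonempty_iso_Q_of_vbModel (hSP : ThomasonTrobaugh_vbModel_of_boundedCoh.{w})
    (B : AbelianVariety ℂ) [HasDerivedCategory.{w} B.X.left.Modules] {K K' : CochainComplex B.X.left.Modules ℤ}
    (hK : IsBoundedVBComplex K) (hK' : IsBoundedVBComplex K') (e : Nonempty (DerivedCategory.Q.obj K ≅ DerivedCategory.Q.obj K')) :
    eulerChar K hK.isFiniteLocallyFree = eulerChar K' hK'.isFiniteLocallyFree := by
  haveI : IsLocallyNoetherian B.X.left := LocallyOfFiniteType.isLocallyNoetherian B.X.hom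
  exact hK.eulerChar_eq_of_nonempty_iso_Q (fun G hG ↦ nonempty_strictlyPerfectResolution_of_coh B hSP hG) hK' e

/-- **`D⁺` variant on a complex abelian variety.** [cite: ThomasonTrobaugh1990, Prop. 2.3.1 (d)] [cite: Schlichting2011HigherKTheory, Exercise 3.1.4] -/
theorem IsBoundedVBComplex.eulerChar_eq_of_nonempty_iso_plusQ_of_vbModel (hSP : ThomasonTrobaugh_vbModel_of_boundedCoh.{w})
    (B : AbelianVariety ℂ) [HasDerivedCategory.{w} B.X.left.Modules] {K K' : CochainComplex B.X.left.Modules ℤ}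
    (hK : IsBoundedVBComplex K) (hK' : IsBoundedVBComplex K') {n n' : ℤ} (hn : K.IsStrictlyGE n) (hn' : K'.IsStrictlyGE n')
    (e : Nonempty (DerivedCategory.Plus.Q.obj ⟨K, n, hn⟩ ≅ DerivedCategory.Plus.Q.obj ⟨K', n', hn'⟩)) :
    eulerChar K hK.isFiniteLocallyFree = eulerChar K' hK'.isFiniteLocallyFree := by
  haveI : IsLocallyNoetherian B.X.left := LocallyOfFiniteType.isLocallyNoetherian B.X.hom
  exact hK.eulerChar_eq_of_nonempty_iso_plusQ (fun G hG ↦ nonempty_strictlyPerfectResolution_of_coh B hSP hG) hK' hn hn' e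

end Literature.AlgebraicGeometry.KTheory

end
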